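import Mathlib
import HarnessLib
import HarnessLib.Audit
import Summits.RiemannHypothesis.Statement
import Literature.NumberTheory.LFunctions.HardyZExtremaCriterion
import Literature.NumberTheory.LFunctions.RHWave0
import Literature.NumberTheory.LFunctions.GeneralizedRH
import Literature.NumberTheory.LFunctions.ZetaRealAxis
import HarnessLib.Audit.Status.Attr

/-!
Route: HardyZLehmerSplit

# Route HardyZLehmerSplit — RH splits as Platt–Trudgian height + no wrong-sign extrema of Hardy Z +
thin-pair dictionary + residual

X = HEIGHT ∧ Σ_L ∧ DICT ∧ Σ_rest ("it suffices to show X"; frozen W-07 c1 C1 object of rh-idea-5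
g14, rev 4, critic VERDICT-W07-1 PASS-as-(s)).
HEIGHT (`HeightPT`, cite conjunct, theorem in print): every zero with 0 < γ ≤ H₀ = 3 000 175 332 800
is on the line (Platt–Trudgian 2021 Thm 1, tree fact).
Σ_L (`SigmaL`, crux): Hardy's Z has no positive local minimum and no negative local maximum at any t
> 3·10¹² (no Lehmer violation above H₀ − 1).
DICT (`Dictionary`, deciding crux, RH-FREE content): an off-line pair ½ ± δ + iγ with γ > H₀ that is
VERY THIN (δ·log²γ ≤ 1/4) and
PAIR-ISOLATED (no other zero of ζ in the critical strip within π/log γ of γ) forces a Lehmer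
violation of Z within π/log γ of γ.
Σ_rest (`SigmaRest`, DECLARED RESIDUAL, RH-strength, never staffed): every off-line pair above H₀ is
very thin and pair-isolated
(no thick pair, no clustered pair). The four conjoin to RH by pure logic plus the strip/quadruple
symmetries of the zeros.
Lean: `HeightPT ∧ SigmaL ∧ Dictionary ∧ SigmaRest`

## Assembly
Pure logic plus standard symmetries, PROVED in glue.lean (`closes`, 0 sorry): a zero s of ζ that is
not trivial and ≠ 1 has
0 < Re s < 1 (`riemannZeta_eq_zero_iff_of_re_nonpos`, Mathlib `riemannZeta_ne_zero_of_one_le_re`)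
and Im s ≠ 0
(`im_ne_zero_of_riemannZeta_eq_zero`); by `riemannZeta_conj` and
`GeneralizedRH.riemannZeta_one_sub_eq_zero` an off-line zero yields
one of the form ½+δ+iγ with δ > 0, γ > 0; γ ≤ H₀ contradicts HeightPT; γ > H₀ gives (SigmaRest) a
thin isolated pair, (Dictionary) a
violation at t with |t−γ| < π/log γ < 1, so t > 3·10¹², contradicting SigmaL. (The deciding theorem
`closes : HeightPT → SigmaL → Dictionary → SigmaRest → Summit.RiemannHypothesis` is certified by the
native check; the Assembly item restates it.)

Rationale: WHY THIS LINE. Mechanism: near a very thin isolated off-line pair the logarithmic derivative Z′/Z(t)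
= Σ_ρ-local terms + O(log γ) is dominated at
t = γ ∓ δ by the pair term ∓1/δ ≥ 4 log²γ, while pair-isolation at radius π/log γ and the explicit
Backlund–Trudgian count
(tree, PROVED: `abs_zetaZeroCount_sub_main_le_explicit`, |N(T) − M(T)| ≤ 0.3083 log T + 4.128) bound
every other contribution by
< 3 log²γ; so Z′/Z changes sign − → + across [γ−δ, γ+δ] with Z ≠ 0 there, which is exactly a
positive local minimum or negative local
maximum of Z (Ivic2003 §2 reads this picture in the RH direction only: RH ⟹ Z′/Z monotone ⟹ no
violation; Edwards1974 §8.3).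
Imported: local Hadamard-product analysis of ξ (complex analysis), explicit zero counting
(Trudgian2014), certified numerics at the
seam (PlattTrudgian2021). What it does that no prior route / negative does: it turns the classical
one-way Lehmer criterion into an
RH-free DICTIONARY «thin isolated off-line pair ⟹ wrong-sign extremum», so that the sign-pattern
statement Σ_L carries a named,
quantified part of RH above the verified height, with the uncarried part typed as an explicit
residual instead of hidden.

RANKED CRUXES. #2 Dictionary (crux) — for γ > 3000175332800, 0 < δ < 1/2 with ζ(½+δ+iγ) = 0, δ·log²γ
≤ 1/4, and every zero of ζ in the open critical strip within π/log γ of height γ equal to one of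
½±δ+iγ: there is t with |t−γ| < π/log γ at which Z has a positive local minimum or a negative local
maximum (W-07 c1 C1 `Dictionary`, rev 4, PairIsolatedAt form demanded by critic rider A).
[difficulty: XL] (why it might fail: the one-sided cluster of ordinary zeros just outside radius
π/log γ contributes up to A₁·log²γ/π to Z′/Z; if the true local constant exceeds ≈3 (Backlund
0.3083·log γ window count at γ≈3·10¹²) the margin 4−3 closes and c=1/4 must shrink (coupled change
in SigmaRest).) [Ivic2003, Edwards1974, Titchmarsh1986, Trudgian2014, arXiv:1612.08627]
#3 SigmaL (crux) — for every t > 3·10¹², a local minimum of Hardy's Z at t has Z(t) ≤ 0 and a local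
maximum has Z(t) ≥ 0 (no Lehmer violation above 3·10¹²; W-07 c1 C1 `SigmaL`). [difficulty:
open-problem] (why it might fail: it is implied by RH only (Ivić: t₀ ≤ 1000) and a single violation
above 3·10¹² refutes it AND RH; RH-free it is open at Laguerre–Pólya strength on the t-line; Lehmer
pairs make near-violations (|Z| < 7.1e-5 between zeros 4.4e-4 apart) recur.) [Ivic2003, Edwards1974,
doi:10.4064/aa111-2-2, arXiv:1612.08627]
#7 SigmaRest (crux) — RESIDUAL (RH-implied, declared residual, never staffed; class (a)
RH-strength): every off-line pair ½±δ+iγ with γ > 3000175332800, 0 < δ < 1/2 is very thin (δ·log²γ ≤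
1/4) and pair-isolated at radius π/log γ — i.e. no THICK and no CLUSTERED off-line pair above the
Platt–Trudgian height; recorded so that `closes` reaches the Statement honestly and the uncarried
part of RH is named, with its constants coupled to Dictionary. [deps: Dictionary] [difficulty:
open-problem] (why it might fail: it fails iff RH fails by a thick (δ·log²γ > 1/4) or clustered pair
above H₀ — the sliver Dictionary cannot see (cell lemmas thin_iff, masked_above_zero); no method
proves statements of this shape short of RH; its risk is the summit's.) [Ivic2003,
PlattTrudgian2021, Titchmarsh1986]
#8 HeightPT (crux) — CITE conjunct HEIGHT(T₀) (theorem in print, certified computation; 0 provers,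
never a proving target; crux-kind only because the deciding theorem may assume crux items only,
ruling 2026-08-16): every zero of ζ with 0 < Im ≤ 3 000 175 332 800 has real part 1/2
(Platt–Trudgian 2021 Thm 1) — the tree's named fact
`Literature.NumberTheory.LFunctions.platt_trudgian_numerical_rh`, used as the hypothesis (h :
HeightPT). [difficulty: open-problem] (why it might fail: mathematically only through an error in
the published interval-arithmetic verification (PlattTrudgian2021 Thm 1, 3·10¹² in γ); as an ITEM it
closes only by porting/certifying that computation in Lean — out of scope, hence 0 provers.)
[PlattTrudgian2021]

TWO-LAYER PLAN. Dictionary ⇐ HadamardLocal → TwoPoint → Dictionary (registered BC3 skeleton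
`Lines/birth.lean`, composition `Dictionary_of` PROVED):
HadamardLocal (XL) = for |t−γ| ≤ δ under Dictionary's hypotheses, Z(t) ≠ 0 and |Z′/Z(t) −
2(t−γ)/((t−γ)²+δ²)| ≤ 3·log²γ; TwoPoint (M) =
Z ≠ 0 on [t₁,t₂], Z′/Z(t₁) < 0 < Z′/Z(t₂) ⟹ a violation in (t₁,t₂). SigmaL ⇐ LaguerreAtCritical →
SecondDerivTest → SigmaL (skeleton,
`SigmaL_of` PROVED): LaguerreAtCritical (XL/open) = t > 3·10¹², Z′(t) = 0, Z(t) ≠ 0 ⟹ Z(t)·Z″(t) <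
0; SecondDerivTest (M) = calculus for
the real-analytic Z. SigmaRest is never decomposed (residual).

KILL CRITERIA. Refutation of Dictionary AS TYPED (an explicit thin isolated configuration, or a
proof that the local constant 3 is exceeded so that
no t exists) closes the route `refuted:Dictionary` unless the refuter's witness only forces a
smaller c (then ONE coupled re-typing of
Dictionary/SigmaRest with c′ < 1/4 is the repair; a second failure retires the line). A certified
Lehmer violation of Z above 3·10¹²
refutes SigmaL and RH together (route moot with the summit). A proof that SigmaRest ⟺ RH
unconditionally (kernel) makes the split
DEGENERATE and retires the route as (p)-record. Proved elsewhere that moots it: any route closing RH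
above H₀.

NOT DECOMPOSED YET. The explicit local constant in HadamardLocal (the «3»): it bundles the one-sided
cluster bound A₁(log γ)/π·log γ, the O(log t) of the
partial-fraction formula made explicit at γ ≥ 3·10¹², and Stirling for the Γ-factor phase ϑ′; these
are layer-2 children of
HadamardLocal once a prover opens it. The C² regularity of hardyZ (second derivative of the
ϑ-expression) inside SecondDerivTest.
No regime split in γ beyond the single seam H₀.

CHEAPEST FALSIFIER. The toy model RUN here (bc/Dictionary_rung.lean, sorry-free, rc 0): Z_toy(t) =
(t²+δ²)·cos t (off-line pair ±iδ at γ = 0, on-line zeros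
at π/2+kπ, pair-isolated at half a mean gap): 0 < δ² < 2 ⟹ positive local MINIMUM at 0 (violation:
thin pair visible), δ² > 2 ⟹
positive local MAXIMUM (thick pair invisible) — both PROVED; the dictionary's mechanism and its
ceiling are real in the model. Next
cheapest: evaluate the one-sided cluster constant at γ = 3·10¹² from
`abs_zetaZeroCount_sub_main_le_explicit` (pencil: (0.3083·28.7+17)
·28.7/π ≈ 236 ≈ 0.29·log²γ per side before the 1/distance weighting; the stub allows 3·log²γ) — a
refuter can do this in an hour.

NUMBERS. H₀ = 3 000 175 332 800 (PlattTrudgian2021 Thm 1; tree `platt_trudgian_numerical_rh`). Σ_L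
threshold 3·10¹² < H₀ − 1; window π/log γ <
π/28.7 < 0.11 < 1. Thinness c = 1/4 at exponent 2 (critic B′: the RH-free pencil needs exponent 2;
necessary c < C/A₁ ≈ π/0.4 ≈ 7.8, so
×30 margin). Isolation radius π/log γ = half the mean gap 2π/log(γ/2π) up to 1+o(1). |S(T)| ≤ 0.3083
log T + 3.24 hence |N(T)−M(T)| ≤
0.3083 log T + 4.128 for T ≥ 30 (tree, PROVED, `ZetaArgBacklundExplicit`). Ivić's RH-conditional t₀
≤ 1000; only known negative local
maximum of Z: −0.52625 at t = 2.47575; no positive local minimum known (Ivic2003 §2). Lehmer/Rosser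
near-violations: |Z| < 7.1·10⁻⁵
between zeros 4.4·10⁻⁴ apart near the 13 400 000th zero (Edwards1974 §8.3 p.176).

BC5 (witness of weakness for the deciding crux Dictionary): toy rung PROVED sorry-free in
bc/Dictionary_rung.lean — for Z_toy(t) =
((t−0)²+δ²)·cos t (one planted pair of offset δ at γ = 0 on a cosine background of unit zero
spacing) `toyDictionary_thin`: 0 < δ, δ² < 2 ⟹
IsLocalMin at 0 with Z_toy 0 > 0 (a violation — the dictionary fires) and `toyDictionary_thick`: δ²
> 2 ⟹ IsLocalMax at 0 (invisible — the
ceiling); outside S's known regime because it is a model statement RH says nothing about, and it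
exercises exactly the lever (cross term
2δ/((t−γ)²+δ²) of Z′/Z against the background). First real rung = plan-only `stub_hadamardLocal`
(bc/Dictionary_birth.lean, technique:
local Hadamard expansion of ξ′/ξ + tree `abs_zetaZeroCount_sub_main_le_explicit` for the far sum).
BC9 (ladder ceiling): method_family = local-Hadamard Z′/Z analysis + explicit zero counting + (Z,
Z′) sign pattern; ladder_ceiling =
capped-at the thin pair-isolated sliver {δ·log²γ ≤ 1/4 and no third zero within π/log γ}: a thick
pair (2/δ² below the background
curvature) leaves every local extremum right-signed (kernel: `thin_iff`, `masked_above_zero` in the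
frozen Sketch fc307f8482aaac25; critic
dossier f7a199c47cf3da21 §B′; toy: `toyDictionary_thick`); in print only the RH ⟹ no-violation
direction exists ([galaxy:panama:500466769199130]
Ivić 1997 §2, [corpus:book:edwards1974-riemann-s-zeta-function p.176], arXiv:1612.08627) and no
converse/ceiling theorem — null for
"positive local minimum|negative local maximum" (galaxy --star all, 20 rows, none beyond Edwards)
and for vsearch «off-line zero pair forces a
positive local minimum of Hardy Z» (top-10: Montgomery–Vaughan p.352–353, Titchmarsh p.36/247,
Edwards p.174/176, all the RH ⟹ direction);
ceiling_lift = SigmaRest (declared crux, residual: everything the dictionary cannot see);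
ceiling_sources = [Literature/Barriers/RiemannHypothesis/JensenPolynomials.lean
(Farmer 2022 §4 shift-0 inefficiency: hyperbolicity for d < T² already follows from RH to height T),
galaxy:panama:500466769199130, corpus:book:edwards1974-riemann-s-zeta-function p.176].

DEFINITION REQUESTS. None: `hardyZ`, `platt_trudgian_numerical_rh`, `IsLocalMin/IsLocalMax`,
`riemannZeta` exist; thin/isolated are inlined as arithmetic
clauses (no new notion filed). Cite fact already in tree: PlattTrudgian2021 Thm 1.

Novelty: Searches (2026-08-29): lit search --hybrid "Lehmer phenomenon positive local minimum Z(t) Riemann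
hypothesis" (hits: Edwards1974 p.174–176, editor1989 p.124 irrelevant); lit vsearch "<off-line pair
forces positive local minimum of Z>" -k 10 (top: Montgomery–Vaughan p.353 refs only, Titchmarsh
p.36/247, Edwards p.174/176 — all the RH ⟹ no-violation direction); lit galaxy search "Lehmer's
phenomenon|Lehmer phenomenon" --star all (Ivić 1997 in Motohashi LMS 247
[galaxy:panama:500466769199130 c320714], Borwein–Choi–Rooney–Weirathmueller reprint of Ivić 2003
[galaxy:panama:432889753763913 c308655], van de Lune MC report ZW 201/83 [galaxy:pdf:5063666700]);
lit galaxy search "positive local minimum|negative local maximum" --star all (20 rows, none on ζ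
beyond Edwards); lean search hardyZ / IsLocalMin over 97 RH Theses files: no route has a
Hardy-Z-extremum crux (DBN, LaguerreSpeiserSplit, DisplacementPencil mention Lehmer pairs only in
rationale); ledger negatives --problem RiemannHypothesis: 7 refuted statements, none on Z-extrema or
off-line pair geometry.
Nearest prior art found: Ivic2003 §2 Prop 1 (arXiv:math/0311162; RH ⟹ (Z′/Z)′ < 0 for t ≥ t₀ ≤ 1000
⟹ no violation; a violation disproves RH) [galaxy:panama:500466769199130]; Edwards1974 §8.3
[corpus:book:edwards1974-riemann-s-zeta-function p.174]; Simonič 2017 (arXiv:1612.08627, Lehmer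
pairs and derivatives of Z, RH-conditional, real zero pairs); Hall 2004 (doi:10.4064/aa111-2-2,
stationary points of Z). In-house: rh-idea-5 g14  [refs: 10.4064/aa111-2-2, math/0311162, 1612.08627, book:edwards1974-riemann-s-zeta-function, doi:10.4064/aa111-2-2, Edwards1974, Ivic2003]

Barriers (technique_class: hardy-z-extrema sign-pattern riemann-siegel zero-counting): - technique_class: hardy-z-extrema sign-pattern riemann-siegel zero-counting
- Literature.Barriers.RiemannHypothesis.GramRosserFailuresNarrow: outside — its own evasions (b)
place «RH ⟹ Z′/Z monotone ⟹ no positive local minimum / negative local maximum» criteria outside the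
class ("they force nothing on S, cannot be refuted by Ω-theorems") and send the converse direction
to the Laguerre–Pólya/Jensen circle; SigmaL yields no N₀(t) ≥ ϑ(t)/π − C (RH itself implies SigmaL
while S is unbounded below).
- Literature.Barriers.RiemannHypothesis.JensenPolynomials: outside — the barrier kills inferences
from LARGE-SHIFT hyperbolicity (EventuallyHyperbolic ⇏ AllHyperbolic); SigmaL/LaguerreAtCritical are
shift-0 statements on the t-line for every t > 3·10¹² and Dictionary is a local converse for thin
pairs; Farmer's shift-0 inefficiency (d < T² follows from RH to height T) is exactly our declared
ceiling: thick pairs are invisible (BC9), carried by SigmaRest.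
- Literature.Barriers.RiemannHypothesis.DavenportHeilbronn: Dictionary is outside (it concludes a
LOCAL sign statement that is equally true for the Davenport–Heilbronn f — the barrier quantifies
over proofs of RH / zero-free regions, not over it); SigmaL and SigmaRest are where it bites: any
proof of them must use the Euler product beyond the functional-equation/Riemann–Siegel class — it
does; the bet is that SigmaL is attacked by certified numerics in finite ranges and at
Laguerre–Pólya strength only, and SigmaRest is the declared r

sub-problem: RiemannHypothesis · status: open · opened planner-plan-w07-sigmaL-1-g0-0 2026-08-29T08:09:12Z · rev 0 · ledger route-RiemannHypothesis-HardyZLehmerSplit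
GENERATED by the gate from the ledger (D-0016/17). Provers cite these decls: `theorem foo : Summit.RiemannHypothesis.RiemannHypothesis.Theses.HardyZLehmerSplit.<Decl> := …` in Summits/RiemannHypothesis/RiemannHypothesis/Theorems/<Name>.lean.
-/

namespace Summit.RiemannHypothesis.RiemannHypothesis.Theses.HardyZLehmerSplit

open scoped BigOperators Topology Manifold Classical MeasureTheory ProbabilityTheory Matrix InnerProductSpace ComplexConjugate ContinuousMap
open Filter Set Function TopologicalSpace MeasureTheory

attribute [summit_statement] _root_.Summit.RiemannHypothesis

open Summit

/-- item stmt-RiemannHypothesis-24248 · crux · rank 2 · closed · proved by DictionaryAssembly.dictionary_crux (prover) · by planner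
why it might fail: the one-sided cluster of ordinary zeros just outside radius π/log γ contributes up to A₁·log²γ/π to Z′/Z; if the true local constant exceeds ≈3 (Backlund 0.3083·log γ window count at γ≈3·10¹²) the margin 4−3 closes and c=1/4 must shrink (coupled change in SigmaRest).
sources: Ivic2003, Edwards1974, Titchmarsh1986, Trudgian2014, arXiv:1612.08627
[crux] for γ > 3000175332800, 0 < δ < 1/2 with ζ(½+δ+iγ) = 0, δ·log²γ ≤ 1/4, and every zero of ζ in
the open critical strip within π/log γ of height γ equal to one of ½±δ+iγ: there is t with |t−γ| <
π/log γ at which Z has a positive local minimum or a negative local maximum (W-07 c1 C1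
`Dictionary`, rev 4, PairIsolatedAt form demanded by critic rider A). [difficulty: XL] -/
@[route_item "route-RiemannHypothesis-HardyZLehmerSplit", crux]
def Dictionary : Prop :=
  ∀ γ δ : ℝ, 3000175332800 < γ → 0 < δ → δ < 1 / 2 → riemannZeta (1 / 2 + δ + γ * Complex.I) = 0 → δ * Real.log γ ^ 2 ≤ 1 / 4 → (∀ s : ℂ, riemannZeta s = 0 → 0 < s.re → s.re < 1 → |s.im - γ| < Real.pi / Real.log γ → s.im = γ ∧ (s.re = 1 / 2 + δ ∨ s.re = 1 / 2 - δ)) → ∃ t : ℝ, |t - γ| < Real.pi / Real.log γ ∧ ((IsLocalMin Literature.NumberTheory.LFunctions.hardyZ t ∧ 0 < Literature.NumberTheory.LFunctions.hardyZ t) ∨ (IsLocalMax Literature.NumberTheory.LFunctions.hardyZ t ∧ Literature.NumberTheory.LFunctions.hardyZ t < 0))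

-- `Dictionary` holds: proved by `DictionaryAssembly.dictionary_crux` (its module imports this route file, so no `_holds` link can be stated here).

/-- item stmt-RiemannHypothesis-24253 · crux · rank 3 · open · by planner
why it might fail: it is implied by RH only (Ivić: t₀ ≤ 1000) and a single violation above 3·10¹² refutes it AND RH; RH-free it is open at Laguerre–Pólya strength on the t-line; Lehmer pairs make near-violations (|Z| < 7.1e-5 between zeros 4.4e-4 apart) recur.
sources: Ivic2003, Edwards1974, doi:10.4064/aa111-2-2, arXiv:1612.08627
[crux] for every t > 3·10¹², a local minimum of Hardy's Z at t has Z(t) ≤ 0 and a local maximum has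
Z(t) ≥ 0 (no Lehmer violation above 3·10¹²; W-07 c1 C1 `SigmaL`). [difficulty: open-problem] -/
@[route_item "route-RiemannHypothesis-HardyZLehmerSplit", crux]
def SigmaL : Prop :=
  ∀ t : ℝ, 3000000000000 < t → (IsLocalMin Literature.NumberTheory.LFunctions.hardyZ t → Literature.NumberTheory.LFunctions.hardyZ t ≤ 0) ∧ (IsLocalMax Literature.NumberTheory.LFunctions.hardyZ t → 0 ≤ Literature.NumberTheory.LFunctions.hardyZ t)

/-- item stmt-RiemannHypothesis-24254 · crux · rank 7 · open · by planner
why it might fail: it fails iff RH fails by a thick (δ·log²γ > 1/4) or clustered pair above H₀ — the sliver Dictionary cannot see (cell lemmas thin_iff, masked_above_zero); no method proves statements of this shape short of RH; its risk is the summit's.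
sources: Ivic2003, PlattTrudgian2021, Titchmarsh1986
[crux] RESIDUAL (RH-implied, declared residual, never staffed; class (a) RH-strength): every
off-line pair ½±δ+iγ with γ > 3000175332800, 0 < δ < 1/2 is very thin (δ·log²γ ≤ 1/4) and
pair-isolated at radius π/log γ — i.e. no THICK and no CLUSTERED off-line pair above the
Platt–Trudgian height; recorded so that `closes` reaches the Statement honestly and the uncarried
part of RH is named, with its constants coupled to Dictionary. [deps: Dictionary] [difficulty:
open-problem] -/
@[route_item "route-RiemannHypothesis-HardyZLehmerSplit", crux (experiment := "instrument: iolationOn (H₀+20) (H₀+30)` from one computational stub `stub_onLine_W0 : OnLineBetween 3000175332819 3000175332840`; certificate job ≤ 30 …") (source := "director RH l.73, 2026-09-01")]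
def SigmaRest : Prop :=
  ∀ γ δ : ℝ, 3000175332800 < γ → 0 < δ → δ < 1 / 2 → riemannZeta (1 / 2 + δ + γ * Complex.I) = 0 → δ * Real.log γ ^ 2 ≤ 1 / 4 ∧ (∀ s : ℂ, riemannZeta s = 0 → 0 < s.re → s.re < 1 → |s.im - γ| < Real.pi / Real.log γ → s.im = γ ∧ (s.re = 1 / 2 + δ ∨ s.re = 1 / 2 - δ))

/-- item stmt-RiemannHypothesis-22032 · crux · rank 8 · open · by planner
why it might fail: mathematically only through an error in the published interval-arithmetic verification (PlattTrudgian2021 Thm 1, 3·10¹² in γ); as an ITEM it closes only by porting/certifying that computation in Lean — out of scope, hence 0 provers.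
sources: PlattTrudgian2021
[support] CITE (computational in print) - RH verified to height 3 000 175 332 800 (Platt-Trudgian
2021 Thm 1) as the tree's named fact `platt_trudgian_numerical_rh` (= `RiemannHypothesisUpTo
3000175332800` by `Iff.rfl`); any T >= 1.82e10 makes RowHTop operative. [difficulty: open-problem] -/
@[route_item "route-RiemannHypothesis-HardyZLehmerSplit", crux]
def HeightPT : Prop :=
  Literature.NumberTheory.LFunctions.platt_trudgian_numerical_rh

/-- item stmt-RiemannHypothesis-24255 · assembly · rank 1 · open · by planner
sources: Ivic2003, PlattTrudgian2021
[assembly] HeightPT → SigmaL → Dictionary → SigmaRest → RiemannHypothesis. -/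
@[route_item "route-RiemannHypothesis-HardyZLehmerSplit"]
def Assembly : Prop :=
  HeightPT → SigmaL → Dictionary → SigmaRest → Summit.RiemannHypothesis

/-! D-0027 §2.1 — DECIDING THEOREM (planner-authored via `route open/edit --closes-file`; by planner-plan-w07-sigmaL-1-g0-0 2026-08-29T08:09:12Z):
its hypotheses are this route's items and its conclusion the sub-problem Statement (glue_lint), and it elaborates with this file. -/

/-- DECIDING THEOREM (D-0027 §2.1): the four items give Mathlib's `RiemannHypothesis`. -/
@[closes "route-RiemannHypothesis-HardyZLehmerSplit"] theorem closes (hH : HeightPT) (hL : SigmaL) (hD : Dictionary) (hR : SigmaRest) :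
    Summit.RiemannHypothesis := by
  -- (K1) no zero `½ + δ + iγ` with `0 < δ < ½`, `0 < γ`.
  have key : ∀ γ δ : ℝ, 0 < γ → 0 < δ → δ < 1 / 2 →
      riemannZeta (1 / 2 + δ + γ * Complex.I) ≠ 0 := by
    intro γ δ hγ hδ hδ' hz
    by_cases hγH : γ ≤ 3000175332800
    · have h := hH (1 / 2 + δ + γ * Complex.I) hz (by simpa using hγ) (by simpa using hγH)
      simp at h
      linarith
    · push Not at hγH
      obtain ⟨hthin, hiso⟩ := hR γ δ hγH hδ hδ' hz
      obtain ⟨t, ht, hv⟩ := hD γ δ hγH hδ hδ' hz hthin hiso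
      have hγpos : (0 : ℝ) < γ := by linarith
      have hlog : Real.pi < Real.log γ := by
        have h4 : Real.pi < 4 := Real.pi_lt_four
        have hexp : Real.exp 4 < γ := by
          have h16 : Real.exp 4 = Real.exp 1 ^ 4 := by
            rw [← Real.exp_nat_mul]; norm_num
          have h3 : Real.exp 1 < 3 := by linarith [Real.exp_one_lt_d9]
          have h81 : Real.exp 1 ^ 4 < 3 ^ 4 := by gcongr
          rw [h16]
          linarith
        have := Real.log_lt_log (Real.exp_pos 4) hexp
        rw [Real.log_exp] at this
        linarith
      have hr : Real.pi / Real.log γ < 1 := by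
        rw [div_lt_one (Real.pi_pos.trans hlog)]
        exact hlog
      have ht' : (3000000000000 : ℝ) < t := by
        have := (abs_lt.1 (ht.trans hr)).1
        linarith
      have hLt := hL t ht'
      rcases hv with ⟨hmin, hpos⟩ | ⟨hmax, hneg⟩
      · exact absurd (hLt.1 hmin) (not_le.2 hpos)
      · exact absurd (hLt.2 hmax) (not_le.2 hneg)
  -- (K2) reduce an arbitrary non-trivial zero to (K1) by the quadruple symmetry.
  show _root_.RiemannHypothesis
  intro s hs htriv hne1
  -- 0 < re s: else trivial zero
  have h0 : 0 < s.re := by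
    by_contra hle
    push Not at hle
    exact htriv ((Literature.NumberTheory.LFunctions.riemannZeta_eq_zero_iff_of_re_nonpos hle).1 hs)
  -- re s < 1: non-vanishing on re ≥ 1
  have h1 : s.re < 1 := by
    by_contra hge
    push Not at hge
    exact riemannZeta_ne_zero_of_one_le_re hge hs
  have him : s.im ≠ 0 :=
    Literature.NumberTheory.LFunctions.im_ne_zero_of_riemannZeta_eq_zero hs h0 h1
  by_contra hne
  -- conjugate and reflected zeros
  have hconj : ∀ z : ℂ, riemannZeta z = 0 → riemannZeta (starRingEnd ℂ z) = 0 := by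
    intro z hz
    rw [riemannZeta_conj, hz, map_zero]
  have hrefl : riemannZeta (1 - s) = 0 :=
    Literature.NumberTheory.LFunctions.GeneralizedRH.riemannZeta_one_sub_eq_zero hs h0 h1
  rcases lt_or_gt_of_ne hne with hlt | hgt
  · -- re s < 1/2 : use 1 - s (re = 1/2 + δ, im = -im s)
    set δ : ℝ := 1 / 2 - s.re with hδdef
    have hδ : 0 < δ := by rw [hδdef]; linarith
    have hδ' : δ < 1 / 2 := by rw [hδdef]; linarith
    rcases lt_or_gt_of_ne him with himneg | himpos
    · -- im s < 0: 1 - s = 1/2 + δ + (-im s) I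
      have e : (1 : ℂ) - s = 1 / 2 + (δ : ℂ) + ((-s.im : ℝ) : ℂ) * Complex.I := by
        apply Complex.ext
        · simp [hδdef]; ring
        · simp [hδdef]
      exact key (-s.im) δ (by linarith) hδ hδ' (e ▸ hrefl)
    · -- im s > 0: conj (1 - s) = 1/2 + δ + (im s) I
      have hz := hconj _ hrefl
      have e : starRingEnd ℂ ((1 : ℂ) - s) = 1 / 2 + (δ : ℂ) + ((s.im : ℝ) : ℂ) * Complex.I := by
        apply Complex.ext
        · simp [hδdef]; ring
        · simp [hδdef]
      exact key s.im δ himpos hδ hδ' (e ▸ hz)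
  · -- re s > 1/2
    set δ : ℝ := s.re - 1 / 2 with hδdef
    have hδ : 0 < δ := by rw [hδdef]; linarith
    have hδ' : δ < 1 / 2 := by rw [hδdef]; linarith
    rcases lt_or_gt_of_ne him with himneg | himpos
    · -- im s < 0: conj s = 1/2 + δ + (-im s) I
      have hz := hconj _ hs
      have e : starRingEnd ℂ s = 1 / 2 + (δ : ℂ) + ((-s.im : ℝ) : ℂ) * Complex.I := by
        apply Complex.ext <;> simp [hδdef]
      exact key (-s.im) δ (by linarith) hδ hδ' (e ▸ hz)
    · -- im s > 0: s itself
      have e : s = 1 / 2 + (δ : ℂ) + ((s.im : ℝ) : ℂ) * Complex.I := by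
        apply Complex.ext <;> simp [hδdef]
      exact key s.im δ himpos hδ hδ' (e ▸ hs)

end Summit.RiemannHypothesis.RiemannHypothesis.Theses.HardyZLehmerSplit
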